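import Mathlib
import HarnessLib
import Summits.ResolutionOfSingularities.ResolutionOfSingularities.Theorems.WildQuotientsWildQuotientResolutionS1aA1Root

/-!
# S1a — INSTANCE I-3 (D₄), ring level, MOVE 3 of MT-D₄ (v1.1): on the (re-coordinated) model ring of the `[z′]` chart the (2,1)-centre `(Y, w)` is admissible
# relative to `β = s·t`, and its residual ideal contains `Y′s₃`, `s·Y′` and `X₁·Z·W′`

[OURS · L1 W4.5c · lead-1 g13; plan-1 RULING R-F15e, X-CERT v1.1 §2 / v1.2-D4ROWS §1 move 3 «centre (X₀″:2, x₂:1); chart N(x₂) KILLED (J̃(x₃) = 1), chart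
[X₀″]₂ RESIDUAL core (e₃, x₂′, e₂)», FRAME-STATUS rev16 §3] — NOT statements of the manuscript; counted 0; AI-level work, weaker than expert review. Crux
stmt-ResolutionOfSingularities-17941 `CyclicQuotientFourfolds`, line `s1a-logminvertex` v13 (`stub_reachLowerInFX`).

ABSTRACT SETTING (lead-1's coordinates; the model ring of the `[z′]` chart of move 2 after the unit recoordination `w := t·Z + s·X₁ = x₂`): a commutative ring `Q`
with elements `t` (= `s₂`, exceptional parameter of move 2), `s` (of move 1), `Y` (= `X₀′T₂`), `X₁` (unit), `Z` (= `z′T₂`, unit), `x₃`, `w` (= `x₂`) and an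
automorphism `τ` with rows `τ t = t`, `τ s = s`, `τ Y = Y`, `τ Z = Z`, `τ X₁ = X₁ + s·t·Y`, `τ x₃ = x₃ − s·t·X₁·Z·w`, `τ w = w + s²·t·Y`, all further generators
`τ`-fixed. Centre `(Y, w)`, weights `(2, 1)`, `β = s·t`, shift 1. On `R^w(Q) = Q[s₃, Y′ = YT², W′ = wT]`:
* `d4m3_admissible`, `d4m3_map_le` — (a′)₁ relative to `β = s·t`;
* ★ `d4m3_augmentationIdeal_sigmaR_le` — (H1): `aug σ_R ≤ (s t · s₃)`;
* `d4m3_sigmaR_X₁_sub` (`= (st s₃)·(Y′s₃)`), `d4m3_sigmaR_u'_one_sub` (`σ_R W′ − W′ = (st s₃)·(s Y′)`), `d4m3_sigmaR_x₃_sub` (`= (st s₃)·(−X₁ Z W′)`);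
* ★ `d4m3_residual_mem` — `Y′s₃, s·Y′, X₁·Z·W′ ∈ 𝔞₃ = (aug σ_R : st·s₃)`: on the norm chart `N(w)` (`W′`, `X₁`, `Z` units) the residual is EMPTY (killed); on
  the `[Y]₂` chart (`Y′` a unit) it is `V(s₃, s, W′)` (= X-CERT's core `(e₃, x₂′, e₂)`: `s ≡ t` modulo `(W′s₃)` by `w = tZ + sX₁`).
-/

set_option linter.dupNamespace false

noncomputable section

open Literature.AlgebraicGeometry.Resolution
open scoped LaurentPolynomial
open Summit.ResolutionOfSingularities.ResolutionOfSingularities.Theorems.WildQuotientResolution.S1.CoarseChart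
open Summit.ResolutionOfSingularities.ResolutionOfSingularities.Theorems.WildQuotientResolution.S1.BlowupCharts

namespace Summit.ResolutionOfSingularities.ResolutionOfSingularities.Theorems.WildQuotientResolution.S1.KillCert.D4

variable {Q : Type} [CommRing Q] (τ : Q ≃+* Q) (t s Y X₁ Z x₃ w : Q) (Gfix : Set Q)
  (ht : τ t = t) (hs : τ s = s) (hY : τ Y = Y) (hZ : τ Z = Z) (hX₁ : τ X₁ = X₁ + s * t * Y) (hx₃ : τ x₃ = x₃ - s * t * X₁ * Z * w)
  (hw : τ w = w + s ^ 2 * t * Y) (hfix : ∀ g ∈ Gfix, τ g = g) (hgen : Subring.closure (({t, s, Y, X₁, Z, x₃, w} : Set Q) ∪ Gfix) = ⊤)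

/-! ## (a′)₁ relative to `β = s·t` -/

include ht hs hY hZ hX₁ hx₃ hw hfix hgen in
/-- **(a′)₁ for move 3 of MT-D₄**: `y ∈ 𝒥ₙ((Y, w), (2,1)) ⇒ τ y − y ∈ (s t)·𝒥ₙ₊₁`. [OURS · L1 W4.5c · R-F15e move 3] -/
theorem d4m3_admissible : ∀ (n : ℕ) (y : Q), y ∈ (weightedFiltration (![Y, w] : Fin 2 → Q) ![2, 1]).ideal n →
    τ y - y ∈ Ideal.span {s * t} * (weightedFiltration (![Y, w] : Fin 2 → Q) ![2, 1]).ideal (n + 1) := by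
  intro n y hy
  have hJ0 : Y ∈ (weightedFiltration (![Y, w] : Fin 2 → Q) ![2, 1]).ideal 2 := mem_weightedFiltration_ideal (![Y, w] : Fin 2 → Q) ![2, 1] 0
  have hJ1 : w ∈ (weightedFiltration (![Y, w] : Fin 2 → Q) ![2, 1]).ideal 1 := mem_weightedFiltration_ideal (![Y, w] : Fin 2 → Q) ![2, 1] 1
  have hsJ : ∀ {m : ℕ} {y : Q}, y ∈ (weightedFiltration (![Y, w] : Fin 2 → Q) ![2, 1]).ideal m →
      s * t * y ∈ Ideal.span {s * t} * (weightedFiltration (![Y, w] : Fin 2 → Q) ![2, 1]).ideal m :=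
    fun hy => Ideal.mul_mem_mul (Ideal.mem_span_singleton_self (s * t)) hy
  have h0 : ∀ m : ℕ, (0 : Q) ∈ Ideal.span {s * t} * (weightedFiltration (![Y, w] : Fin 2 → Q) ![2, 1]).ideal m := fun m => Ideal.zero_mem _
  have m_X₁ : τ X₁ - X₁ ∈ Ideal.span {s * t} * (weightedFiltration (![Y, w] : Fin 2 → Q) ![2, 1]).ideal 1 := by
    rw [hX₁, show X₁ + s * t * Y - X₁ = s * t * Y by ring]; exact hsJ ((weightedFiltration _ _).antitone (by norm_num : 1 ≤ 2) hJ0)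
  have m_x₃ : τ x₃ - x₃ ∈ Ideal.span {s * t} * (weightedFiltration (![Y, w] : Fin 2 → Q) ![2, 1]).ideal 1 := by
    rw [hx₃, show x₃ - s * t * X₁ * Z * w - x₃ = s * t * (-(X₁ * Z) * w) by ring]
    exact hsJ (Ideal.mul_mem_left _ _ hJ1)
  have m_w : τ w - w ∈ Ideal.span {s * t} * (weightedFiltration (![Y, w] : Fin 2 → Q) ![2, 1]).ideal 2 := by
    rw [hw, show w + s ^ 2 * t * Y - w = s * t * (s * Y) by ring]
    exact hsJ (Ideal.mul_mem_left _ _ hJ0)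
  refine admissible_of_generators (![Y, w] : Fin 2 → Q) ![2, 1] τ (s * t) _ hgen ?_ ?_ n y hy
  · rintro g (hg | hg)
    · simp only [Set.mem_insert_iff, Set.mem_singleton_iff] at hg
      rcases hg with rfl | rfl | rfl | rfl | rfl | rfl | rfl
      · rw [ht, sub_self]; exact h0 1
      · rw [hs, sub_self]; exact h0 1
      · rw [hY, sub_self]; exact h0 1
      · exact m_X₁
      · rw [hZ, sub_self]; exact h0 1
      · exact m_x₃
      · exact (Ideal.mul_mono_right ((weightedFiltration _ _).antitone (by norm_num : 1 ≤ 2))) m_w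
    · rw [hfix g hg, sub_self]; exact h0 1
  · intro i
    fin_cases i
    · change τ Y - Y ∈ Ideal.span {s * t} * (weightedFiltration (![Y, w] : Fin 2 → Q) ![2, 1]).ideal (2 + 1)
      rw [hY, sub_self]; exact h0 3
    · exact m_w

include ht hs hY hZ hX₁ hx₃ hw hfix hgen in
/-- **`τ`-stability** of the move-3 filtration. -/
theorem d4m3_map_le : ∀ n : ℕ,
    ((weightedFiltration (![Y, w] : Fin 2 → Q) ![2, 1]).ideal n).map (τ : Q →+* Q) ≤ (weightedFiltration (![Y, w] : Fin 2 → Q) ![2, 1]).ideal n :=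
  fun n => map_le_of_admissible (![Y, w] : Fin 2 → Q) ![2, 1] τ (s * t) (d4m3_admissible τ t s Y X₁ Z x₃ w Gfix ht hs hY hZ hX₁ hx₃ hw hfix hgen) n

/-! ## (H1) and the residual ideal -/

section Residual

variable {p : ℕ} (hp : 0 < p) (hσp : ∀ x : Q, (⇑τ)^[p] x = x)

include ht hs hY hZ hX₁ hx₃ hw hfix hgen in
/-- ★ **(H1) for move 3 of MT-D₄**: on `R^w(Q) = Q[s₃, YT², wT]`, `aug σ_R ≤ (s t · s₃)`. -/
theorem d4m3_augmentationIdeal_sigmaR_le :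
    augmentationIdeal (sigmaR τ (![Y, w] : Fin 2 → Q) ![2, 1] (d4m3_map_le τ t s Y X₁ Z x₃ w Gfix ht hs hY hZ hX₁ hx₃ hw hfix hgen) hp hσp) ≤
      Ideal.span {algebraMap Q _ (s * t) * cobordantAlgebra.s (![Y, w] : Fin 2 → Q) ![2, 1]} :=
  augmentationIdeal_sigmaR_le_span_of_admissible (![Y, w] : Fin 2 → Q) ![2, 1] τ _ hp hσp (s * t)
    (d4m3_admissible τ t s Y X₁ Z x₃ w Gfix ht hs hY hZ hX₁ hx₃ hw hfix hgen)

include hX₁ in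
/-- Row of `X₁`: `σ_R X₁ − X₁ = s t Y = (st·s₃)·(Y′ s₃)` (`Y′ = YT²`). -/
theorem d4m3_sigmaR_X₁_sub
    (hσJ : ∀ n : ℕ, ((weightedFiltration (![Y, w] : Fin 2 → Q) ![2, 1]).ideal n).map (τ : Q →+* Q) ≤ (weightedFiltration (![Y, w] : Fin 2 → Q) ![2, 1]).ideal n) :
    sigmaR τ (![Y, w] : Fin 2 → Q) ![2, 1] hσJ hp hσp (algebraMap Q _ X₁) - algebraMap Q _ X₁ =
      (algebraMap Q _ (s * t) * cobordantAlgebra.s (![Y, w] : Fin 2 → Q) ![2, 1]) *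
        (cobordantAlgebra.u' (![Y, w] : Fin 2 → Q) ![2, 1] 0 * cobordantAlgebra.s (![Y, w] : Fin 2 → Q) ![2, 1]) := by
  refine Subtype.ext ?_
  rw [AddSubgroupClass.coe_sub, MulMemClass.coe_mul, MulMemClass.coe_mul, MulMemClass.coe_mul, sigmaR_algebraMap, cobordantAlgebra.coe_algebraMap,
    cobordantAlgebra.coe_algebraMap, cobordantAlgebra.coe_algebraMap, cobordantAlgebra.coe_s, cobordantAlgebra.coe_u']
  change LaurentPolynomial.C (τ X₁) - LaurentPolynomial.C X₁ =
    LaurentPolynomial.C (s * t) * LaurentPolynomial.T (-1) * (LaurentPolynomial.C Y * LaurentPolynomial.T ((2 : ℕ) : ℤ) * LaurentPolynomial.T (-1))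
  rw [hX₁]
  simp only [map_add, map_mul]
  have hT : LaurentPolynomial.T (-1) * (LaurentPolynomial.T ((2 : ℕ) : ℤ) * LaurentPolynomial.T (-1)) = (1 : Q[T;T⁻¹]) := by
    rw [← LaurentPolynomial.T_add, ← LaurentPolynomial.T_add]; norm_num
  calc _ = LaurentPolynomial.C s * LaurentPolynomial.C t * LaurentPolynomial.C Y *
        (LaurentPolynomial.T (-1) * (LaurentPolynomial.T ((2 : ℕ) : ℤ) * LaurentPolynomial.T (-1))) := by rw [hT]; ring
    _ = _ := by ring

include hw in
/-- Row of `W′ = wT`: `σ_R W′ − W′ = s² t Y·T = (st·s₃)·(s·Y′)`. -/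
theorem d4m3_sigmaR_u'_one_sub
    (hσJ : ∀ n : ℕ, ((weightedFiltration (![Y, w] : Fin 2 → Q) ![2, 1]).ideal n).map (τ : Q →+* Q) ≤ (weightedFiltration (![Y, w] : Fin 2 → Q) ![2, 1]).ideal n) :
    sigmaR τ (![Y, w] : Fin 2 → Q) ![2, 1] hσJ hp hσp (cobordantAlgebra.u' (![Y, w] : Fin 2 → Q) ![2, 1] 1) - cobordantAlgebra.u' (![Y, w] : Fin 2 → Q) ![2, 1] 1 =
      (algebraMap Q _ (s * t) * cobordantAlgebra.s (![Y, w] : Fin 2 → Q) ![2, 1]) *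
        (algebraMap Q _ s * cobordantAlgebra.u' (![Y, w] : Fin 2 → Q) ![2, 1] 0) := by
  refine Subtype.ext ?_
  have hu1 : cobordantAlgebra.u' (![Y, w] : Fin 2 → Q) ![2, 1] 1 =
      ⟨LaurentPolynomial.C w * LaurentPolynomial.T (((![2, 1] : Fin 2 → ℕ) 1 : ℕ) : ℤ), (cobordantAlgebra.u' (![Y, w] : Fin 2 → Q) ![2, 1] 1).2⟩ := rfl
  rw [AddSubgroupClass.coe_sub, MulMemClass.coe_mul, MulMemClass.coe_mul, MulMemClass.coe_mul, cobordantAlgebra.coe_algebraMap, cobordantAlgebra.coe_algebraMap,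
    cobordantAlgebra.coe_s, cobordantAlgebra.coe_u', hu1, sigmaR_mk, cobordantAlgebra.coe_u']
  change LaurentPolynomial.C (τ w) * LaurentPolynomial.T ((1 : ℕ) : ℤ) - LaurentPolynomial.C w * LaurentPolynomial.T ((1 : ℕ) : ℤ) =
    LaurentPolynomial.C (s * t) * LaurentPolynomial.T (-1) * (LaurentPolynomial.C s * (LaurentPolynomial.C Y * LaurentPolynomial.T ((2 : ℕ) : ℤ)))
  rw [hw]
  simp only [map_add, map_mul, map_pow]
  have hT : LaurentPolynomial.T (-1) * LaurentPolynomial.T ((2 : ℕ) : ℤ) = (LaurentPolynomial.T ((1 : ℕ) : ℤ) : Q[T;T⁻¹]) := by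
    rw [← LaurentPolynomial.T_add]; norm_num
  calc _ = LaurentPolynomial.C s ^ 2 * LaurentPolynomial.C t * LaurentPolynomial.C Y * (LaurentPolynomial.T (-1) * LaurentPolynomial.T ((2 : ℕ) : ℤ)) := by
        rw [hT]; ring
    _ = _ := by ring

include hx₃ in
/-- Row of `x₃`: `σ_R x₃ − x₃ = −s t X₁ Z w = (st·s₃)·(−X₁·Z·W′)` (`w = W′ s₃`). -/
theorem d4m3_sigmaR_x₃_sub
    (hσJ : ∀ n : ℕ, ((weightedFiltration (![Y, w] : Fin 2 → Q) ![2, 1]).ideal n).map (τ : Q →+* Q) ≤ (weightedFiltration (![Y, w] : Fin 2 → Q) ![2, 1]).ideal n) :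
    sigmaR τ (![Y, w] : Fin 2 → Q) ![2, 1] hσJ hp hσp (algebraMap Q _ x₃) - algebraMap Q _ x₃ =
      (algebraMap Q _ (s * t) * cobordantAlgebra.s (![Y, w] : Fin 2 → Q) ![2, 1]) *
        -(algebraMap Q _ X₁ * algebraMap Q _ Z * cobordantAlgebra.u' (![Y, w] : Fin 2 → Q) ![2, 1] 1) := by
  refine Subtype.ext ?_
  rw [AddSubgroupClass.coe_sub, MulMemClass.coe_mul, NegMemClass.coe_neg, MulMemClass.coe_mul, MulMemClass.coe_mul, MulMemClass.coe_mul, sigmaR_algebraMap,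
    cobordantAlgebra.coe_algebraMap, cobordantAlgebra.coe_algebraMap, cobordantAlgebra.coe_algebraMap, cobordantAlgebra.coe_algebraMap, cobordantAlgebra.coe_algebraMap,
    cobordantAlgebra.coe_s, cobordantAlgebra.coe_u']
  change LaurentPolynomial.C (τ x₃) - LaurentPolynomial.C x₃ =
    LaurentPolynomial.C (s * t) * LaurentPolynomial.T (-1) *
      -(LaurentPolynomial.C X₁ * LaurentPolynomial.C Z * (LaurentPolynomial.C w * LaurentPolynomial.T ((1 : ℕ) : ℤ)))
  rw [hx₃]
  simp only [map_sub, map_mul]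
  have hT : LaurentPolynomial.T (-1) * LaurentPolynomial.T ((1 : ℕ) : ℤ) = (1 : Q[T;T⁻¹]) := by
    rw [← LaurentPolynomial.T_add]; norm_num
  calc _ = -(LaurentPolynomial.C s * LaurentPolynomial.C t * LaurentPolynomial.C X₁ * LaurentPolynomial.C Z * LaurentPolynomial.C w *
        (LaurentPolynomial.T (-1) * LaurentPolynomial.T ((1 : ℕ) : ℤ))) := by rw [hT]; ring
    _ = _ := by ring

include ht hs hY hZ hX₁ hx₃ hw hfix hgen in
/-- ★ **`Y′s₃ ∈ 𝔞₃`**, ★ **`s·Y′ ∈ 𝔞₃`**, ★ **`X₁·Z·W′ ∈ 𝔞₃`** — the residual ideal `(aug σ_R : st·s₃)` of move 3: the norm chart `N(w)` (`W′` a unit) is KILLED;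
on the `[Y]₂` chart (`Y′` a unit) the residual is `V(s₃, s, W′)`. [OURS · L1 W4.5c · X-CERT v1.2-D4ROWS move 3] -/
theorem d4m3_residual_mem :
    cobordantAlgebra.u' (![Y, w] : Fin 2 → Q) ![2, 1] 0 * cobordantAlgebra.s (![Y, w] : Fin 2 → Q) ![2, 1] ∈
        (augmentationIdeal (sigmaR τ (![Y, w] : Fin 2 → Q) ![2, 1] (d4m3_map_le τ t s Y X₁ Z x₃ w Gfix ht hs hY hZ hX₁ hx₃ hw hfix hgen) hp hσp)).colon
          (Ideal.span {algebraMap Q _ (s * t) * cobordantAlgebra.s (![Y, w] : Fin 2 → Q) ![2, 1]}) ∧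
      algebraMap Q _ s * cobordantAlgebra.u' (![Y, w] : Fin 2 → Q) ![2, 1] 0 ∈
        (augmentationIdeal (sigmaR τ (![Y, w] : Fin 2 → Q) ![2, 1] (d4m3_map_le τ t s Y X₁ Z x₃ w Gfix ht hs hY hZ hX₁ hx₃ hw hfix hgen) hp hσp)).colon
          (Ideal.span {algebraMap Q _ (s * t) * cobordantAlgebra.s (![Y, w] : Fin 2 → Q) ![2, 1]}) ∧
      algebraMap Q _ X₁ * algebraMap Q _ Z * cobordantAlgebra.u' (![Y, w] : Fin 2 → Q) ![2, 1] 1 ∈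
        (augmentationIdeal (sigmaR τ (![Y, w] : Fin 2 → Q) ![2, 1] (d4m3_map_le τ t s Y X₁ Z x₃ w Gfix ht hs hY hZ hX₁ hx₃ hw hfix hgen) hp hσp)).colon
          (Ideal.span {algebraMap Q _ (s * t) * cobordantAlgebra.s (![Y, w] : Fin 2 → Q) ![2, 1]}) := by
  refine ⟨?_, ?_, ?_⟩
  · rw [Ideal.mem_colon_span_singleton, mul_comm, ← d4m3_sigmaR_X₁_sub τ t s Y X₁ w hX₁ hp hσp]
    exact sub_mem_augmentationIdeal _ _
  · rw [Ideal.mem_colon_span_singleton, mul_comm, ← d4m3_sigmaR_u'_one_sub τ t s Y w hw hp hσp]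
    exact sub_mem_augmentationIdeal _ _
  · rw [Ideal.mem_colon_span_singleton]
    have h := neg_mem (sub_mem_augmentationIdeal
      (sigmaR τ (![Y, w] : Fin 2 → Q) ![2, 1] (d4m3_map_le τ t s Y X₁ Z x₃ w Gfix ht hs hY hZ hX₁ hx₃ hw hfix hgen) hp hσp) (algebraMap Q _ x₃))
    rw [d4m3_sigmaR_x₃_sub τ t s Y X₁ Z x₃ w hx₃ hp hσp] at h
    convert h using 1
    ring

end Residual

end Summit.ResolutionOfSingularities.ResolutionOfSingularities.Theorems.WildQuotientResolution.S1.KillCert.D4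

end
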